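import Summits.ResolutionOfSingularities.ResolutionOfSingularities.Theorems.HilbertSamuelEliminationSigmaMaxModificationsCorridor3NearStep
import Literature.AlgebraicGeometry.Resolution.StalkIdealGenerization
import HarnessLib

/-!
# [OURS · L1 W4.2] A blown-up ISOLATED marked point is blown up AS A POINT: the canonical centre at an isolated point of the
# Hilbert–Samuel locus is the reduced point (crux `SigmaMaxModifications` stmt-ResolutionOfSingularities-18506; conjunct
# `SigmaMaxModificationsCorridor3` stmt-…-19249; line `w_ladder` v6 — unit STARTS of the units-half, `IsoLowDirDimTerminatesM`)

Stub worker res-L1-w42-stub-1 (gen 3). Helper file `--supports stmt-ResolutionOfSingularities-19249 --as helper`; kernel only, no named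
fact, no new definition. Continues `…Corridor3NearStep` (the genuine-step package).

* `stalkIdeal_eq_maximalIdeal_of_support_inter_subset_singleton` — **pure scheme lemma**: if the stalk `C_v` of an ideal sheaf `C` at
  `v` is a PRIME ideal and some open neighbourhood `U ∋ v` meets the support `V(C)` only in `v`, then `C_v = 𝔪_v` (the generisation
  `η_q` of `v` defined by the prime `q = C_v` lies in `V(C) ∩ U`, Stacks 01J7; `Spec 𝒪_{X,v} → X` is injective).
* `IsMaximalOrigin.stalkIdeal_centre_eq_maximalIdeal_of_iso` — **at a stage reached from a maximal origin (`ν ≠ Φ^{(N)}`, admissible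
  oracle) whose marked point `x_n` is ISOLATED in the Hilbert–Samuel locus (`Moving.Iso`, CJS Def. 13.3) the centre `C` of every
  canonical step through `x_n` has stalk `C_{x_n} = 𝔪_{x_n}`**: the centre is permissible (regular quotient ⇒ prime stalk) and lies in
  `X_n(ν) ⊆ (X_n)_max` (`IsMaximalOrigin.centre_package`; `ν` is maximal at every good stage). I.e. the genuine step at an isolated point
  is, locally at `x_n`, the blow-up of the POINT — the first step `X_1 = Bℓ_x(X)` of a fundamental sequence / unit (CJS Def. 6.34 (i),
  Def. 6.38 (i)); consumed by the units-half (`UnitTowerExtractionQM`: unit starts at `Iso` stages), by `IsoLowDirDimTerminatesM`, and by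
  the W-top `EvIso` sub-row (`IsIsoPointTower`).

OURS bookkeeping over the tree's rendering of CJS Rem. 6.29 (1); NOT a statement of the manuscript [Hironaka2017] nor of
[CossartJannsenSaito2020]. AI-written; AI review is weaker than expert review.

References: V. Cossart, U. Jannsen, S. Saito, LNM 2270 (2020), Def. 3.1, Def. 6.34 (i), Def. 6.38 (i), Def. 13.3, Rem. 6.29 (1)
[CossartJannsenSaito2020]; The Stacks Project, Tag 01J7 [StacksProject].
-/

noncomputable section

set_option linter.dupNamespace false -- mandated namespace of this single-conjunct summit

open CategoryTheory AlgebraicGeometry TopologicalSpace Topology IsLocalRing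

namespace Summit.ResolutionOfSingularities.ResolutionOfSingularities.Theorems

namespace CampaignW42

open Literature.AlgebraicGeometry.Resolution Literature.RingTheory.HilbertSamuel
open Literature.AlgebraicGeometry.CossartJannsenSaito2020
open Summit.ResolutionOfSingularities.ResolutionOfSingularities.Theorems.SigmaMaxModificationsCorridor3

universe u

variable {p : ℕ} {R : ∀ S : Scheme.{u}, CentreSeq S → Prop} {N : ℕ} {ν : ℕ → ℕ}

/-! ## §1. A prime stalk whose support is isolated at the point is the maximal ideal -/

/-- A point of `Spec 𝒪_{X,v}` maps into the support of an ideal sheaf `I` iff the corresponding prime contains the stalk `I_v`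
(Stacks 01J7; the stalk at the generisation is the extension of `I_v`, tree `stalkIdeal_map_stalkSpecializes`). [cite: StacksProject, Tag 01J7] -/
theorem fromSpecStalk_mem_support_iff_stalkIdeal_le {X : Scheme.{u}} {v : X} (I : X.IdealSheafData)
    (q : PrimeSpectrum (X.presheaf.stalk v)) : X.fromSpecStalk v q ∈ I.support ↔ stalkIdeal I v ≤ q.asIdeal := by
  rw [mem_support_iff_stalkIdeal_le_primeOfSpecializes (fromSpecStalk_specializes q) I, primeOfSpecializes_fromSpecStalk]

/-- **A PRIME stalk of an ideal sheaf whose support is isolated at the point is the maximal ideal**: if `C_v` is prime and an open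
`U ∋ v` meets `V(C)` only in `v`, then `C_v = 𝔪_v` — the generisation of `v` defined by the prime `C_v` lies in `V(C)`, specialises
to `v`, hence lies in `U`, so it is `v` itself. [cite: StacksProject, Tag 01J7] -/
theorem stalkIdeal_eq_maximalIdeal_of_support_inter_subset_singleton {X : Scheme.{u}} (C : X.IdealSheafData) {v : X}
    (hprime : (stalkIdeal C v).IsPrime) {U : Set X} (hU : IsOpen U) (hvU : v ∈ U)
    (hiso : (C.support : Set X) ∩ U ⊆ {v}) : stalkIdeal C v = maximalIdeal (X.presheaf.stalk v) := by
  let q : PrimeSpectrum (X.presheaf.stalk v) := ⟨stalkIdeal C v, hprime⟩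
  have hmem : X.fromSpecStalk v q ∈ (C.support : Set X) :=
    (fromSpecStalk_mem_support_iff_stalkIdeal_le C q).mpr le_rfl
  have hspec : X.fromSpecStalk v q ⤳ v := fromSpecStalk_specializes q
  have hU' : X.fromSpecStalk v q ∈ U := hspec.mem_open hU hvU
  have heq : X.fromSpecStalk v q = v := hiso ⟨hmem, hU'⟩
  have hq : q = closedPoint (X.presheaf.stalk v) := by
    apply (X.fromSpecStalk v).isEmbedding.injective
    rw [heq, Scheme.fromSpecStalk_closedPoint]
  exact congrArg PrimeSpectrum.asIdeal hq

/-- The stalk of a centre which is permissible at `v` (CJS Def. 3.1: regular quotient) is a prime ideal. [cite: CossartJannsenSaito2020, Def. 3.1] -/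
theorem isPrime_stalkIdeal_of_isPermissibleAt {X : Scheme.{u}} {C : X.IdealSheafData} {v : X}
    (h : IdealSheafData.IsPermissibleAt C v) : (stalkIdeal C v).IsPrime := by
  haveI := h.isRegularLocalRing
  haveI : IsDomain (X.presheaf.stalk v ⧸ stalkIdeal C v) := isDomain_of_isRegularLocalRing _
  exact (Ideal.Quotient.isDomain_iff_prime _).mp inferInstance

/-! ## §2. At an ISOLATED marked point the canonical centre is the point -/

/-- At a good state `ν` is a MAXIMAL value of `H^N` on the stage (it is attained at any point of the stratum and never exceeded).
[folklore] -/
theorem StateGood.maximal_of_mem {k : Type u} [Field k] {W : Scheme.{u}} {L : Labelling W} {P : Option (Pending W)}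
    (hg : StateGood k R N ν W L P) {w : W} (hw : w ∈ Scheme.hsStratum W N ν) : Maximal (· ∈ Scheme.hsValues W N) ν :=
  ⟨⟨w, Scheme.mem_hsStratum_iff.mp hw⟩, fun μ ⟨w', hw'⟩ hle => by subst hw'; exact (hg.supMax w' hle).le⟩

/-- At a good state the `ν`-stratum lies in the Hilbert–Samuel locus `(X_n)_max`. [cite: CossartJannsenSaito2020, Def. 2.35] -/
theorem StateGood.hsStratum_subset_hsMaxLocus {k : Type u} [Field k] {W : Scheme.{u}} {L : Labelling W} {P : Option (Pending W)}
    (hg : StateGood k R N ν W L P) : Scheme.hsStratum W N ν ⊆ Scheme.hsMaxLocus W N := by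
  intro w hw
  rw [Scheme.mem_hsMaxLocus_iff, Scheme.mem_hsStratum_iff.mp hw]
  exact hg.maximal_of_mem hw

/-- **AT AN ISOLATED MARKED POINT THE CANONICAL CENTRE IS THE POINT.** At a stage `s` reached from a maximal origin (admissible oracle,
`ν ≠ Φ^{(N)}`) whose marked point `x_n` is isolated in the Hilbert–Samuel locus (`Moving.Iso N s`, CJS Def. 13.3), every canonical step
`(s.L, s.P) ↦ C` whose centre passes through `x_n` has `C_{x_n} = 𝔪_{x_n}`: the centre is permissible (prime stalk) and supported in
`X_n(ν) ⊆ (X_n)_max`, which an open neighbourhood of `x_n` meets only in `x_n`. Locally at `x_n` the genuine step is the blow-up of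
the point (CJS Def. 6.34 (i) / Def. 6.38 (i): `X_1 = Bℓ_x(X)`). [cite: CossartJannsenSaito2020, Def. 13.3, Def. 6.34 (i), Rem. 6.29 (1)] -/
theorem IsMaximalOrigin.stalkIdeal_centre_eq_maximalIdeal_of_iso (hRa : OracleAdmissible R) (hν : ν ≠ iterPSum N Phi)
    {X : Scheme.{u}} [IsLocallyNoetherian X] {x : X} (hX : IsMaximalOrigin p N ν X x) {s : MarkedStage.{u}}
    (hs : Reaches R N ν (MarkedStage.init X x) s) (hiso : Moving.Iso N s) {C : s.W.IdealSheafData}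
    {P' : Option (Pending (blowup C))} (hst : IsCanonicalStep R N ν s.L s.P C P') (hmem : s.pt ∈ (C.support : Set s.W)) :
    stalkIdeal C s.pt = maximalIdeal (s.W.presheaf.stalk s.pt) := by
  haveI : IsLocallyNoetherian s.W := s.ln
  obtain ⟨-, hsub, hperm, -⟩ := hX.centre_package hRa hν hs hst
  obtain ⟨k, _, _, hg⟩ := hX.exists_stateGood_of_reaches hRa hν hs
  obtain ⟨U, hU, hUmax⟩ := hiso
  have hvU : s.pt ∈ U := by
    have : s.pt ∈ U ∩ Scheme.hsMaxLocus s.W N := by rw [hUmax]; exact Set.mem_singleton _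
    exact this.1
  refine stalkIdeal_eq_maximalIdeal_of_support_inter_subset_singleton C
    (isPrime_stalkIdeal_of_isPermissibleAt (hperm s.pt hmem)) hU hvU ?_
  rintro w ⟨hwC, hwU⟩
  have hwmax : w ∈ Scheme.hsMaxLocus s.W N := hg.hsStratum_subset_hsMaxLocus (hsub hwC)
  have : w ∈ U ∩ Scheme.hsMaxLocus s.W N := ⟨hwU, hwmax⟩
  rwa [hUmax] at this

/-- **GENUINE STEP AT AN ISOLATED POINT = POINT BLOW-UP, in-scope form.** Along a canonical near step `s → s'` from a stage in scope
(`Moving.InScopeM`, functional admissible oracle, `ν ≠ Φ^{(N)}`) at which the marked point is isolated in the Hilbert–Samuel locus and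
blown up: the blow-down map `π : X_{n+1} → X_n` is a blow-up of a centre `C` with `C_{x_n} = 𝔪_{x_n}`, and `x_{n+1}` is a closed
near point over `x_n`. [cite: CossartJannsenSaito2020, Def. 6.34 (i), Def. 13.3, Rem. 6.29 (1)] -/
theorem CanonicalNearStep.exists_point_centre_of_iso (hRf : OracleFunctional R) (hRa : OracleAdmissible R)
    (hν : ν ≠ iterPSum N Phi) {s s' : MarkedStage.{u}} (hs : Moving.InScopeM p R N ν s) (h : CanonicalNearStep R N ν s s')
    (hb : s.IsBlownUp R N ν) (hiso : Moving.Iso N s) :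
    ∃ (C : s.W.IdealSheafData) (π : s'.W ⟶ s.W),
      IsBlowup π C ∧ IdealSheafData.IsPermissible C ∧ stalkIdeal C s.pt = maximalIdeal (s.W.presheaf.stalk s.pt) ∧
      π.base s'.pt = s.pt ∧ IsClosed ({s'.pt} : Set s'.W) ∧ IsClosed ({s.pt} : Set s.W) ∧
      Scheme.hsFun s'.W N s'.pt = Scheme.hsFun s.W N s.pt ∧ Scheme.hsFun s.W N s.pt = ν ∧
      Scheme.IsExcellent s.W ∧ topologicalKrullDim s.W ≤ (N : WithBot ℕ∞) := by
  obtain ⟨X, hX, x, horig, hreach⟩ := hs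
  have hpt : s.pt ∈ Scheme.hsStratum s.W N ν := Moving.pt_mem_hsStratum_of_reaches horig.mem_stratum hreach
  have hcls : IsClosed ({s.pt} : Set s.W) := Reaches.isClosed_pt horig.isClosed hreach
  obtain ⟨k, _, _, hg⟩ := horig.exists_stateGood_of_reaches hRa hν hreach
  obtain ⟨C, P', hln, x', hst, hπ, hcl, hx', rfl⟩ := h
  haveI : IsLocallyNoetherian s.W := s.ln
  have hmem : s.pt ∈ (C.support : Set s.W) := hb.mem_support hRf hst
  have hν' : Scheme.hsFun s.W N s.pt = ν := Scheme.mem_hsStratum_iff.mp hpt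
  refine ⟨C, blowup.π C, blowup.isBlowup C, hg.isPermissible hst,
    horig.stalkIdeal_centre_eq_maximalIdeal_of_iso hRa hν hreach hiso hst hmem, hπ, hcl, hcls, ?_, hν', hg.isExcellent, hg.dim_le⟩
  show Scheme.hsFun (blowup C) N x' = Scheme.hsFun s.W N s.pt
  rw [Scheme.mem_hsStratum_iff.mp hx', hν']

end CampaignW42

end Summit.ResolutionOfSingularities.ResolutionOfSingularities.Theorems

end
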